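import Mathlib
import HarnessLib

/-!
# Route `LangevinControlUV`, crux `FemtoCurvatureTwoPoint` (stmt-QuantumFields-9363), line `generic-step-gamma-encoding`:
# the encoding arithmetic (step index, threshold ladder, generic step values, encoded shape)

The PROVED measure-free half of the line (skeleton `Cruxes/FemtoCurvatureTwoPoint/Lines/generic_step_gamma_encoding.lean`,
§ "The generic-step encoding"), landed verbatim from the skeleton so that the line's composition can live under
`Theorems/` (companions: `…TwoPointDefs*.lean`, `…TwoPointEncodingCrux.lean`, `…TwoPointReduction*.lean`).
Pure real arithmetic, no lattice objects:

* `stepIdx β = ⌊log₂⌊β⌋₊⌋` with `2^k ≤ β < 2^{k+1}` (`two_pow_stepIdx_le`, `lt_two_pow_stepIdx_succ`, `le_stepIdx_of_le`);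
* the monotone envelope `env B` of a threshold tower `B : ℕ → ℝ` and the threshold LADDER `ladder B k` = the largest
  `L ≤ 2^k` with `env B L ≤ 2^k` (`threshold_le`: `L ≤ ladder B k ∧ 2^k ≤ β ⇒ B L ≤ β`);
* the step values `alphaEnc B t k = (1 + t·2^{-k}) / (ladder B k + 1)` (`0 < α_k ≤ …`; `le_ladder_of_femto`: `L·α_k ≤ 1 ⇒
  L ≤ ladder B k`), and the GENERICITY lemma `exists_generic`: for any positive sequence `u` there is `t ∈ [0,1]` with
  `√m · (1 + t 2^{-k}) u_k ≠ √m' · (1 + t 2^{-k'}) u_{k'}` whenever `k ≠ k'`, `m, m' ≥ 1` (countably many bad `t`);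
* the encoded shape `gammaEnc α s = 4^{-k}` if `s = √m · α_k` for some `m ≥ 1` (well defined under genericity,
  `gammaEnc_eq`), `= 1` otherwise; `0 < gammaEnc ≤ 1`;
* one step of arithmetic `band_to_levels` / `allpairs_to_levels`: on `2^k ≤ β < 2^{k+1}` a two-sided bound
  `c ≤ β²·Y ≤ C` becomes `(c/4)·4^{-k} ≤ Y ≤ |C|·4^{-k}`.

Registered sub-goal of the crux item: `exists_generic`.
-/

set_option autoImplicit false

noncomputable section

open scoped BigOperators
open MeasureTheory Filter Topology

namespace Summit.QuantumFields.YangMills.Cruxes.FemtoCurvatureTwoPoint.GenericStepGammaEncoding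

/-! ## § The generic-step encoding (proved): `C⁺ ⇒ crux`

### Step index `k(β)` with `2^k ≤ β < 2^{k+1}` (as in `Ideator2.crux_of_deepBand`) -/

/-- Step index `k(β) = ⌊log₂ ⌊β⌋₊⌋`. -/
def stepIdx (β : ℝ) : ℕ := Nat.log 2 ⌊β⌋₊

/-- `2^{k(β)} ≤ β` for `β ≥ 1`. -/
theorem two_pow_stepIdx_le {β : ℝ} (hβ : 1 ≤ β) : (2 : ℝ) ^ stepIdx β ≤ β := by
  have hfl : ⌊β⌋₊ ≠ 0 := (Nat.floor_pos.2 hβ).ne'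
  have h1 : 2 ^ Nat.log 2 ⌊β⌋₊ ≤ ⌊β⌋₊ := Nat.pow_log_le_self 2 hfl
  have h2 : ((2 ^ Nat.log 2 ⌊β⌋₊ : ℕ) : ℝ) ≤ (⌊β⌋₊ : ℝ) := by exact_mod_cast h1
  have h3 : (⌊β⌋₊ : ℝ) ≤ β := Nat.floor_le (by linarith)
  have h4 : ((2 ^ Nat.log 2 ⌊β⌋₊ : ℕ) : ℝ) = (2 : ℝ) ^ stepIdx β := by
    rw [stepIdx]; push_cast; ring
  rw [← h4]
  exact h2.trans h3

/-- `β < 2^{k(β)+1}`. -/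
theorem lt_two_pow_stepIdx_succ (β : ℝ) : β < (2 : ℝ) ^ (stepIdx β + 1) := by
  have h1 : ⌊β⌋₊ < 2 ^ (Nat.log 2 ⌊β⌋₊ + 1) := Nat.lt_pow_succ_log_self (by norm_num) ⌊β⌋₊
  have h2 : ⌊β⌋₊ + 1 ≤ 2 ^ (Nat.log 2 ⌊β⌋₊ + 1) := h1
  have h3 : ((⌊β⌋₊ + 1 : ℕ) : ℝ) ≤ ((2 ^ (Nat.log 2 ⌊β⌋₊ + 1) : ℕ) : ℝ) := by exact_mod_cast h2
  have h4 : β < (⌊β⌋₊ : ℝ) + 1 := Nat.lt_floor_add_one β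
  calc β < (⌊β⌋₊ : ℝ) + 1 := h4
    _ = ((⌊β⌋₊ + 1 : ℕ) : ℝ) := by push_cast; ring
    _ ≤ ((2 ^ (Nat.log 2 ⌊β⌋₊ + 1) : ℕ) : ℝ) := h3
    _ = (2 : ℝ) ^ (stepIdx β + 1) := by rw [stepIdx]; push_cast; ring

/-- `2^K ≤ β ⇒ K ≤ k(β)`: the step index is unbounded along `β → ∞`. -/
theorem le_stepIdx_of_le {K : ℕ} {β : ℝ} (h : (2 : ℝ) ^ K ≤ β) : K ≤ stepIdx β := by
  have h0 : (0 : ℝ) ≤ β := le_trans (by positivity) h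
  have h1 : (2 : ℕ) ^ K ≤ ⌊β⌋₊ := by
    refine Nat.le_floor ?_
    push_cast
    exact h
  unfold stepIdx
  exact Nat.le_log_of_pow_le (by norm_num) h1

/-! ### The threshold ladder -/

/-- Monotone envelope of a threshold function: `T(L) = L + Σ_{i ≤ L} |B i|`. -/
def env (B : ℕ → ℝ) (L : ℕ) : ℝ := (L : ℝ) + ∑ i ∈ Finset.range (L + 1), |B i|

/-- `L ≤ env B L`. -/
theorem le_env (B : ℕ → ℝ) (L : ℕ) : (L : ℝ) ≤ env B L := by
  have := Finset.sum_nonneg fun i (_ : i ∈ Finset.range (L + 1)) => abs_nonneg (B i)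
  simp only [env]; linarith

/-- `B L ≤ env B L` (the envelope dominates the tower). -/
theorem self_le_env (B : ℕ → ℝ) (L : ℕ) : B L ≤ env B L := by
  have h1 : |B L| ≤ ∑ i ∈ Finset.range (L + 1), |B i| :=
    Finset.single_le_sum (fun i _ => abs_nonneg (B i)) (Finset.self_mem_range_succ L)
  have h2 := le_abs_self (B L)
  have h3 : (0 : ℝ) ≤ L := Nat.cast_nonneg L
  simp only [env]; linarith

/-- The envelope is monotone in `L`. -/
theorem env_mono (B : ℕ → ℝ) {L L' : ℕ} (h : L ≤ L') : env B L ≤ env B L' := by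
  simp only [env]
  have h1 : ∑ i ∈ Finset.range (L + 1), |B i| ≤ ∑ i ∈ Finset.range (L' + 1), |B i| :=
    Finset.sum_le_sum_of_subset_of_nonneg (Finset.range_mono (by omega)) fun i _ _ => abs_nonneg (B i)
  have h2 : (L : ℝ) ≤ L' := by exact_mod_cast h
  linarith

/-- The ladder: `L_k = max {L ≤ 2^k : T(L) ≤ 2^k}` — the largest torus validated in step `k`. -/
def ladder (B : ℕ → ℝ) (k : ℕ) : ℕ := Nat.findGreatest (fun L => env B L ≤ (2 : ℝ) ^ k) (2 ^ k)

/-- Every `L` with `env B L ≤ 2^k` lies below the ladder rung `ladder B k`. -/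
theorem le_ladder (B : ℕ → ℝ) {k L : ℕ} (h : env B L ≤ (2 : ℝ) ^ k) : L ≤ ladder B k := by
  have h1 : (L : ℝ) ≤ (2 : ℝ) ^ k := (le_env B L).trans h
  have h2 : L ≤ 2 ^ k := by exact_mod_cast h1
  exact Nat.le_findGreatest (P := fun L => env B L ≤ (2 : ℝ) ^ k) h2 h

/-- The ladder rung itself satisfies `env B (ladder B k) ≤ 2^k` (when it is non-zero). -/
theorem env_ladder_le (B : ℕ → ℝ) {k : ℕ} (hk : ladder B k ≠ 0) : env B (ladder B k) ≤ (2 : ℝ) ^ k :=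
  Nat.findGreatest_of_ne_zero (P := fun L => env B L ≤ (2 : ℝ) ^ k) rfl hk

/-- On a torus validated in step `k` the threshold is passed for every `β ≥ 2^k`. -/
theorem threshold_le (B : ℕ → ℝ) {k L : ℕ} (hL1 : 1 ≤ L) (hL : L ≤ ladder B k) {β : ℝ}
    (hβ : (2 : ℝ) ^ k ≤ β) : B L ≤ β := by
  have hk : ladder B k ≠ 0 := by omega
  exact (self_le_env B L).trans (((env_mono B hL).trans (env_ladder_le B hk)).trans hβ)

/-! ### Generic step values `α_k = u_k (1 + t 2^{-k})`, `u_k = 1/(L_k + 1)` -/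

/-- The step values `α_k = (1 + t 2^{-k}) / (L_k + 1)`. -/
def alphaEnc (B : ℕ → ℝ) (t : ℝ) (k : ℕ) : ℝ :=
  ((ladder B k : ℝ) + 1)⁻¹ * (1 + t * ((2 : ℝ) ^ k)⁻¹)

/-- The step values are positive (`t ≥ 0`). -/
theorem alphaEnc_pos (B : ℕ → ℝ) {t : ℝ} (ht : 0 ≤ t) (k : ℕ) : 0 < alphaEnc B t k := by
  unfold alphaEnc; positivity

/-- `α_k ≤ 2 / (ladder B k + 1)` for `t ≤ 1`. -/
theorem alphaEnc_le (B : ℕ → ℝ) {t : ℝ} (ht1 : t ≤ 1) (k : ℕ) :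
    alphaEnc B t k ≤ 2 / ((ladder B k : ℝ) + 1) := by
  have hx : ((2 : ℝ) ^ k)⁻¹ ≤ 1 := inv_le_one_of_one_le₀ (one_le_pow₀ (by norm_num))
  have hx0 : (0 : ℝ) ≤ ((2 : ℝ) ^ k)⁻¹ := by positivity
  have h1 : 1 + t * ((2 : ℝ) ^ k)⁻¹ ≤ 2 := by nlinarith [mul_le_mul ht1 hx hx0 zero_le_one]
  have hpos : (0 : ℝ) < ((ladder B k : ℝ) + 1)⁻¹ := by positivity
  calc alphaEnc B t k = ((ladder B k : ℝ) + 1)⁻¹ * (1 + t * ((2 : ℝ) ^ k)⁻¹) := rfl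
    _ ≤ ((ladder B k : ℝ) + 1)⁻¹ * 2 := mul_le_mul_of_nonneg_left h1 hpos.le
    _ = 2 / ((ladder B k : ℝ) + 1) := by rw [mul_comm, div_eq_mul_inv]

/-- **Femto ⇒ validated**: `L · α_k ≤ 1` forces `L ≤ L_k` (because `α_k > 1/(L_k + 1)`). -/
theorem le_ladder_of_femto (B : ℕ → ℝ) {t : ℝ} (ht : 0 < t) {k L : ℕ}
    (hL : (L : ℝ) * alphaEnc B t k ≤ 1) : L ≤ ladder B k := by
  by_contra hlt
  have hle : (ladder B k : ℝ) + 1 ≤ L := by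
    exact_mod_cast Nat.lt_iff_add_one_le.1 (not_le.1 hlt)
  have hpos : (0 : ℝ) < (ladder B k : ℝ) + 1 := by positivity
  have hx : (0 : ℝ) < t * ((2 : ℝ) ^ k)⁻¹ := by positivity
  have h1 : (L : ℝ) * alphaEnc B t k = (L : ℝ) * (1 + t * ((2 : ℝ) ^ k)⁻¹) / ((ladder B k : ℝ) + 1) := by
    unfold alphaEnc; ring
  rw [h1, div_le_one hpos] at hL
  nlinarith


/-- **Genericity.** For positive `u_k` there is `t ∈ [1/2, 1]` such that the level sets
`{√m · u_k (1 + t 2^{-k}) : m ≥ 1}` of distinct steps are disjoint: for `k ≠ k'` and fixed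
`m, m'` the collision equation is affine in `t` with at most one root (two roots force
`2^{-k} = 2^{-k'}`), so the bad `t` form a countable, Lebesgue-null set. -/
theorem exists_generic (u : ℕ → ℝ) (hu : ∀ k, 0 < u k) :
    ∃ t : ℝ, 1 / 2 ≤ t ∧ t ≤ 1 ∧ ∀ (k k' m m' : ℕ), k ≠ k' → 1 ≤ m → 1 ≤ m' →
      Real.sqrt m * (u k * (1 + t * ((2 : ℝ) ^ k)⁻¹)) ≠
        Real.sqrt m' * (u k' * (1 + t * ((2 : ℝ) ^ k')⁻¹)) := by
  classical
  let Bad : Set ℝ := ⋃ k : ℕ, ⋃ k' : ℕ, ⋃ m : ℕ, ⋃ m' : ℕ,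
    {t : ℝ | k ≠ k' ∧ 1 ≤ m ∧ 1 ≤ m' ∧
      Real.sqrt m * (u k * (1 + t * ((2 : ℝ) ^ k)⁻¹)) =
        Real.sqrt m' * (u k' * (1 + t * ((2 : ℝ) ^ k')⁻¹))}
  have hsub : ∀ (k k' m m' : ℕ), Set.Subsingleton {t : ℝ | k ≠ k' ∧ 1 ≤ m ∧ 1 ≤ m' ∧
      Real.sqrt m * (u k * (1 + t * ((2 : ℝ) ^ k)⁻¹)) =
        Real.sqrt m' * (u k' * (1 + t * ((2 : ℝ) ^ k')⁻¹))} := by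
    intro k k' m m' t ht t' ht'
    obtain ⟨hkk, hm, -, hteq⟩ := ht
    obtain ⟨-, -, -, ht'eq⟩ := ht'
    have hP : 0 < Real.sqrt m * u k := mul_pos (Real.sqrt_pos.2 (by exact_mod_cast hm)) (hu k)
    have e1 : (Real.sqrt m * u k * ((2 : ℝ) ^ k)⁻¹ - Real.sqrt m' * u k' * ((2 : ℝ) ^ k')⁻¹) *
        (t - t') = 0 := by
      linear_combination hteq - ht'eq
    rcases mul_eq_zero.1 e1 with hA | htt
    · exfalso
      have e2 : Real.sqrt m * u k = Real.sqrt m' * u k' := by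
        linear_combination hteq - t * hA
      have e3 : Real.sqrt m * u k * ((2 : ℝ) ^ k)⁻¹ = Real.sqrt m * u k * ((2 : ℝ) ^ k')⁻¹ := by
        linear_combination hA - ((2 : ℝ) ^ k')⁻¹ * e2
      have e4 : ((2 : ℝ) ^ k)⁻¹ = ((2 : ℝ) ^ k')⁻¹ := mul_left_cancel₀ hP.ne' e3
      have e5 : (2 : ℝ) ^ k = (2 : ℝ) ^ k' := inv_injective e4
      have e6 : (2 : ℕ) ^ k = 2 ^ k' := by exact_mod_cast e5
      exact hkk (Nat.pow_right_injective le_rfl e6)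
    · exact sub_eq_zero.1 htt
  have hcount : Bad.Countable :=
    Set.countable_iUnion fun k => Set.countable_iUnion fun k' =>
      Set.countable_iUnion fun m => Set.countable_iUnion fun m' => (hsub k k' m m').countable
  have hB0 : volume Bad = 0 := hcount.measure_zero volume
  have hIcc : volume (Set.Icc (1 / 2 : ℝ) 1) ≠ 0 := by
    rw [Real.volume_Icc, Ne, ENNReal.ofReal_eq_zero]; norm_num
  have hns : ¬ Set.Icc (1 / 2 : ℝ) 1 ⊆ Bad := fun hs => hIcc (measure_mono_null hs hB0)
  obtain ⟨t, htI, htB⟩ := Set.not_subset.1 hns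
  refine ⟨t, htI.1, htI.2, fun k k' m m' hkk hm hm' heq => htB ?_⟩
  simp only [Bad, Set.mem_iUnion, Set.mem_setOf_eq]
  exact ⟨k, k', m, m', hkk, hm, hm', heq⟩

/-! ### The encoded shape `Γ` -/

open Classical in
/-- `Γ(√m · α_k) = 4^{-k}` on the level sets (`m ≥ 1`), `Γ = 1` elsewhere. -/
def gammaEnc (α : ℕ → ℝ) (s : ℝ) : ℝ :=
  if h : ∃ k m : ℕ, 1 ≤ m ∧ s = Real.sqrt m * α k then ((4 : ℝ) ^ (Classical.choose h))⁻¹ else 1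

/-- `0 < Γ`. -/
theorem gammaEnc_pos (α : ℕ → ℝ) (s : ℝ) : 0 < gammaEnc α s := by
  unfold gammaEnc; split_ifs <;> positivity

/-- `Γ ≤ 1`. -/
theorem gammaEnc_le_one (α : ℕ → ℝ) (s : ℝ) : gammaEnc α s ≤ 1 := by
  unfold gammaEnc
  split_ifs
  · exact inv_le_one_of_one_le₀ (one_le_pow₀ (by norm_num))
  · exact le_rfl

/-- Under genericity of `α`, `Γ(√m · α_k) = 4^{-k}` (`m ≥ 1`). -/
theorem gammaEnc_eq {α : ℕ → ℝ}
    (hgen : ∀ (k k' m m' : ℕ), k ≠ k' → 1 ≤ m → 1 ≤ m' →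
      Real.sqrt m * α k ≠ Real.sqrt m' * α k')
    (k m : ℕ) (hm : 1 ≤ m) : gammaEnc α (Real.sqrt m * α k) = ((4 : ℝ) ^ k)⁻¹ := by
  have h : ∃ k' m' : ℕ, 1 ≤ m' ∧ Real.sqrt m * α k = Real.sqrt m' * α k' := ⟨k, m, hm, rfl⟩
  unfold gammaEnc
  rw [dif_pos h]
  obtain ⟨m', hm', heq⟩ := Classical.choose_spec h
  have hk : Classical.choose h = k := by
    by_contra hne
    exact hgen k (Classical.choose h) m m' (Ne.symm hne) hm hm' heq
  rw [hk]

/-! ### One step of arithmetic: `2^k ≤ β < 2^{k+1}` turns `[c, C]·β⁻²` into levels -/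

/-- On the step `2^k ≤ β < 2^{k+1}`: `c ≤ β²(n⁸Y)` and `β²(|Y| n⁸) ≤ C` give
`(c/4)·4^{-k} ≤ n⁸ Y ≤ |C|·4^{-k}`. -/
theorem band_to_levels {β c C Y : ℝ} {k : ℕ} (h2k : (2 : ℝ) ^ k ≤ β) (hβlt : β < (2 : ℝ) ^ (k + 1))
    (hc : 0 < c) (h_lo : c ≤ β ^ 2 * Y) (h_hi : β ^ 2 * Y ≤ C) :
    c / 4 * ((4 : ℝ) ^ k)⁻¹ ≤ Y ∧ Y ≤ |C| * ((4 : ℝ) ^ k)⁻¹ := by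
  have h2kpos : 0 < (2 : ℝ) ^ k := by positivity
  have hβpos : 0 < β := h2kpos.trans_le h2k
  have hβ2 : 0 < β ^ 2 := by positivity
  have h4k : (4 : ℝ) ^ k = ((2 : ℝ) ^ k) ^ 2 := by
    rw [show (4 : ℝ) = 2 ^ 2 by norm_num, ← pow_mul, mul_comm, pow_mul]
  have h4k1 : (4 : ℝ) ^ (k + 1) = ((2 : ℝ) ^ (k + 1)) ^ 2 := by
    rw [show (4 : ℝ) = 2 ^ 2 by norm_num, ← pow_mul, mul_comm, pow_mul]
  have hle : (4 : ℝ) ^ k ≤ β ^ 2 := by rw [h4k]; exact pow_le_pow_left₀ h2kpos.le h2k 2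
  have hlt : β ^ 2 ≤ (4 : ℝ) ^ (k + 1) := by
    rw [h4k1]; exact (pow_lt_pow_left₀ hβlt hβpos.le two_ne_zero).le
  have h4pos : 0 < (4 : ℝ) ^ k := by positivity
  constructor
  · have hY : c / β ^ 2 ≤ Y := by rw [div_le_iff₀ hβ2]; linarith
    have h1 : c / (4 : ℝ) ^ (k + 1) ≤ c / β ^ 2 := div_le_div_of_nonneg_left hc.le hβ2 hlt
    have h2 : c / 4 * ((4 : ℝ) ^ k)⁻¹ = c / (4 : ℝ) ^ (k + 1) := by rw [pow_succ]; field_simp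
    rw [h2]; exact h1.trans hY
  · have hY : Y ≤ C / β ^ 2 := by rw [le_div_iff₀ hβ2]; linarith
    have h1 : C / β ^ 2 ≤ |C| / β ^ 2 := div_le_div_of_nonneg_right (le_abs_self C) hβ2.le
    have h2 : |C| / β ^ 2 ≤ |C| / (4 : ℝ) ^ k := div_le_div_of_nonneg_left (abs_nonneg C) h4pos hle
    rw [← div_eq_mul_inv]
    exact hY.trans (h1.trans h2)

/-- On the step `2^k ≤ β < 2^{k+1}`: `β² Y ≤ C` with `Y ≥ 0` gives `Y ≤ |C|·4^{-k}`. -/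
theorem allpairs_to_levels {β C Y : ℝ} {k : ℕ} (h2k : (2 : ℝ) ^ k ≤ β) (_hY : 0 ≤ Y)
    (h : β ^ 2 * Y ≤ C) : Y ≤ |C| * ((4 : ℝ) ^ k)⁻¹ := by
  have h2kpos : 0 < (2 : ℝ) ^ k := by positivity
  have hβpos : 0 < β := h2kpos.trans_le h2k
  have hβ2 : 0 < β ^ 2 := by positivity
  have h4k : (4 : ℝ) ^ k = ((2 : ℝ) ^ k) ^ 2 := by
    rw [show (4 : ℝ) = 2 ^ 2 by norm_num, ← pow_mul, mul_comm, pow_mul]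
  have hle : (4 : ℝ) ^ k ≤ β ^ 2 := by rw [h4k]; exact pow_le_pow_left₀ h2kpos.le h2k 2
  have h4pos : 0 < (4 : ℝ) ^ k := by positivity
  have h0 : Y ≤ C / β ^ 2 := by rw [le_div_iff₀ hβ2]; linarith
  have h1 : C / β ^ 2 ≤ |C| / β ^ 2 := div_le_div_of_nonneg_right (le_abs_self C) hβ2.le
  have h2 : |C| / β ^ 2 ≤ |C| / (4 : ℝ) ^ k := div_le_div_of_nonneg_left (abs_nonneg C) h4pos hle
  rw [← div_eq_mul_inv]
  exact h0.trans (h1.trans h2)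

end Summit.QuantumFields.YangMills.Cruxes.FemtoCurvatureTwoPoint.GenericStepGammaEncoding

end
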